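import Mathlib
import Literature.MathematicalPhysics.QuantumFieldTheory.Balaban1983to89.TreeLengthTorusTransfer

/-!
# `Balaban1983to89.B13Ineq232Torus` — T. Bałaban, *Renormalization group approach to lattice gauge field theories.
II. Cluster expansions*, Commun. Math. Phys. **116** (1988) 1–22 [Balaban1988RG2Cluster]: the connected components
of a family of cubes OF THE TORUS and the inequality (2.32) p. 18 — in its kernel form, constant 2 + 4d (d = 4: 18,
the cell's repaired constant of `B13.Consts.R16repaired`) — PROVED for `torusTreeLen` on the papers' periodic carrier

statement-level skeleton of published theorems with citation tags; proofs where landed; nothing here is a claim about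
the Yang–Mills mass gap

PDF held: `paper:balaban1988-cmp116-rg-ii-cluster` (journal page = PDF page + 0); p. 18 re-read this session from the
text layer `p0018.txt` of that key (the display (2.32) is garbled there; it is quoted from the render
`pub-balaban/b2b-balaban-b13/renders/…-p018-x2.png` in the docstring of `…B13Ineq232.CompData`, cross-read by the cell).

CITATION HEADER / WHAT IS REPRODUCED (unit `lit-balaban-r10` gen 10, B13 fold owner; SKELETON rows `B13.Eq2.32`,
`B13.Eq2.10` of `HOME/lit-balaban-r10/ROWS-B13.md`, HOME = `run/shared/lean/pub/lit-balaban/`; kind «model-instance on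
the torus»).  P. 18 [PDF 18], verbatim: *"In general the set Z₀ is a union of connected components. Let us denote one
of the components by Z₀. It contains Y₀ = ∪_i Y_i. By a simple geometric argument we have Σ_i d_k(Y_i) + 4M⁻⁴|Z₀∖Y₀|
≧ d_k(Z₀). (2.32)"*; p. 14 (2.10): *"Z = ∪_i Z_i, where Z_i are connected components of Z"*; p. 20: *"Using the
inequality (2.32), properly adapted to the new situation"* (components Z′_i of Z′₀ inside Z ∈ 𝐃_{k+1}).  The window
(ℤ^d) versions are `B13Eq210Components.compF/compsF` (components, via `B14Components.WConn`) and
`B13Ineq232.CompData.ineq232_subst` / `B13Ineq232TreeLength.ineq232_treeLen` ((2.32)-substitute, constant 1 + 4d by the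
growth argument with [Dimock2013] Lemma 20 and the n = 2 union claim).  HERE, on the periodic index model
`TreeLengthTorus.TPt d N = (ℤ/N)^d` with torus wall adjacency `TAdj` (wrap-around walls included):
* Part 1 — the connected components `tcomp S a` / `tcomps S` of a finite family S̄ of cubes of the torus (chains
  `TLinked S`), with the partition laws (`biUnion_tcomps`, `tcomps_disjoint`), the separation law (distinct components
  have no common torus wall, `tcomps_sep`), each component a torus localization domain (`isTDom_tcomp`), and *"𝐃 =
  ∪_i 𝐃_i"* (a connected family inside S̄ lies inside one component, `subset_tcomp_of_tFaceConnected`);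
* Part 2 — the COUNTING behind (2.32): inside a torus localization domain Z̄ ⊇ S̄, if S̄ has at least two components
  then every component has a common torus wall with a cube of Z̄ ∖ S̄ (`exists_sdiff_tadj`), whence
  #components − 1 ≤ 2d·|Z̄ ∖ S̄| (`card_tcomps_sub_one_le`);
* Part 3 — **(2.32) ON THE TORUS**: for a torus localization domain Z̄ and ∅ ≠ S̄ ⊆ Z̄ with components Y_i,
  `torusTreeLen Z̄ ≤ Σ_i torusTreeLen Y_i + (2 + 4d)·|Z̄ ∖ S̄|` (`ineq232_torus`; d = 4: constant 18,
  `ineq232_torus_four`) — by (2.27) on the torus (`TreeLengthTorusGeometry.torusTreeLen_biUnion_add_two_le`, gluing cost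
  2 per member) applied to the family {Y_i} ∪ {{□} : □ ∈ Z̄ ∖ S̄}, whose union is Z̄, plus the counting of Part 2.
No `sorry`, no new named fact (D-0026); Mathlib + `…TreeLengthTorusTransfer` (hence `…TreeLengthTorus`,
`…TreeLengthTorusGeometry`) only; nothing existing is modified.

HONEST SCOPE.  (i) (2.32) AS PRINTED (constant 4) is false for the tree length of [Balaban1987RG1] (cell GAPS.md
G-B13-08, `B13Ineq232Star`); the kernel constant here is 2 + 4d (= 18 at d = 4, EXACTLY the cell's hand-repaired
constant of `B13.Consts.R16repaired : 18κ ≤ γ₂ε₁²γ⁻²/20`), one worse than the window's 1 + 4d because every join of the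
torus gluing `exists_tAdmissible_glue` is charged 2 (a join through a common wall), also for the single extra cubes
which the window's growth argument adjoins at cost 1; the sharper constant is not pursued.  (ii) `torusTreeLen` is the
covering-space reading of d_j on the torus (READING D-pv22g2.1, conventions D-pv22.1 of `…TreeLength`).  (iii) Nothing
analytic and nothing about Lemma 3 is asserted here; the consumers are the torus instance of the resummation
pp. 17–20 (`B13Lemma3Assembly.bound238With_of_226`, hypotheses `h2732`/`h232`).  Value = kernel-checked carrier
migration of the components / (2.32) bookkeeping to the papers' periodic carrier, NOT summit progress.
-/

noncomputable section

namespace Literature.MathematicalPhysics.QuantumFieldTheory.Balaban1983to89.B13Ineq232Torus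

open Literature.MathematicalPhysics.QuantumFieldTheory.Balaban1983to89
open Literature.MathematicalPhysics.QuantumFieldTheory.Balaban1983to89.TreeLengthTorus
open Literature.MathematicalPhysics.QuantumFieldTheory.Balaban1983to89.TreeLengthTorusGeometry
open Literature.MathematicalPhysics.QuantumFieldTheory.Balaban1983to89.TreeLengthTorusTransfer

variable {d N : ℕ}

/-! ## Part 1. The connected components of a finite family of cubes of the torus -/

open Classical in
/-- The connected component of the cube ā in the finite family S̄ of cubes of the torus — the `Z_i ∋ ā` of (2.10)
p. 14 *"Z = ∪_i Z_i, where Z_i are connected components of Z"*, chains of cubes with common torus walls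
(`TreeLengthTorus.TLinked`); window version `B13Eq210Components.compF`. [cite: Balaban1988RG2Cluster, (2.10) p.14] -/
def tcomp (S : Finset (TPt d N)) (a : TPt d N) : Finset (TPt d N) := S.filter fun b => TLinked S a b

/-- The family {Z₁, …, Z_n} of the connected components of S̄ on the torus (2.10); window version
`B13Eq210Components.compsF`. [cite: Balaban1988RG2Cluster, (2.10) p.14] -/
def tcomps (S : Finset (TPt d N)) : Finset (Finset (TPt d N)) := S.image (tcomp S)

/-- Membership in a component: b̄ ∈ Z_i(ā) iff b̄ ∈ S̄ is chain-connected to ā inside S̄. [cite: Balaban1988RG2Cluster, (2.10) p.14] -/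
theorem mem_tcomp {S : Finset (TPt d N)} {a b : TPt d N} : b ∈ tcomp S a ↔ b ∈ S ∧ TLinked S a b := by
  classical
  exact Finset.mem_filter

/-- A component is a sub-family. [cite: Balaban1988RG2Cluster, (2.10) p.14] -/
theorem tcomp_subset (S : Finset (TPt d N)) (a : TPt d N) : tcomp S a ⊆ S := fun _ hb => (mem_tcomp.1 hb).1

/-- A cube lies in its own component. [cite: Balaban1988RG2Cluster, (2.10) p.14] -/
theorem mem_tcomp_self {S : Finset (TPt d N)} {a : TPt d N} (ha : a ∈ S) : a ∈ tcomp S a :=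
  mem_tcomp.2 ⟨ha, Relation.ReflTransGen.refl⟩

/-- The component of ā is non-empty when ā ∈ S̄. [cite: Balaban1988RG2Cluster, (2.10) p.14] -/
theorem tcomp_nonempty {S : Finset (TPt d N)} {a : TPt d N} (ha : a ∈ S) : (tcomp S a).Nonempty :=
  ⟨a, mem_tcomp_self ha⟩

/-- Components are determined by any of their cubes: b̄ ∈ Z_i(ā) ⇒ Z_i(b̄) = Z_i(ā). [cite: Balaban1988RG2Cluster, (2.10) p.14] -/
theorem tcomp_eq_of_mem {S : Finset (TPt d N)} {a b : TPt d N} (hb : b ∈ tcomp S a) : tcomp S b = tcomp S a := by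
  obtain ⟨-, hab⟩ := mem_tcomp.1 hb
  ext c
  simp only [mem_tcomp]
  constructor
  · rintro ⟨hc, hbc⟩
    exact ⟨hc, tLinked_trans hab hbc⟩
  · rintro ⟨hc, hac⟩
    exact ⟨hc, tLinked_trans (tLinked_symm hab) hac⟩

/-- A chain inside S̄ starting at ā stays inside the component of ā: it is a chain inside Z_i(ā). [cite: Balaban1988RG2Cluster, (2.10) p.14] -/
theorem tLinked_tcomp {S : Finset (TPt d N)} {a b : TPt d N} (h : TLinked S a b) : TLinked (tcomp S a) a b := by
  unfold TLinked at h ⊢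
  induction h with
  | refl => exact Relation.ReflTransGen.refl
  | @tail x y hax hxy ih =>
    have hx : x ∈ tcomp S a := mem_tcomp.2 ⟨hxy.1, hax⟩
    have hy : y ∈ tcomp S a := mem_tcomp.2 ⟨hxy.2.1, hax.tail hxy⟩
    exact ih.tail ⟨hx, hy, hxy.2.2⟩

/-- **Components are connected families** ([Balaban1987RG1] p. 257: *"for every pair □, □′ of cubes from the family
there exists a sequence □, □₁, …, □_n, □′ of cubes belonging to the family and such that two consecutive cubes have a
common wall"*), on the torus. [cite: Balaban1988RG2Cluster, (2.10) p.14] -/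
theorem tFaceConnected_tcomp (S : Finset (TPt d N)) (a : TPt d N) : TFaceConnected (tcomp S a) := by
  intro x hx y hy
  have hax : TLinked (tcomp S a) a x := tLinked_tcomp (mem_tcomp.1 hx).2
  have hay : TLinked (tcomp S a) a y := tLinked_tcomp (mem_tcomp.1 hy).2
  exact tLinked_trans (tLinked_symm hax) hay

/-- Membership in the family of components. [cite: Balaban1988RG2Cluster, (2.10) p.14] -/
theorem mem_tcomps {S : Finset (TPt d N)} {K : Finset (TPt d N)} : K ∈ tcomps S ↔ ∃ a ∈ S, tcomp S a = K :=
  Finset.mem_image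

/-- Every component is a non-empty sub-family of S̄. [cite: Balaban1988RG2Cluster, (2.10) p.14] -/
theorem subset_of_mem_tcomps {S : Finset (TPt d N)} {K : Finset (TPt d N)} (hK : K ∈ tcomps S) :
    K ⊆ S ∧ K.Nonempty := by
  obtain ⟨a, ha, rfl⟩ := mem_tcomps.1 hK
  exact ⟨tcomp_subset S a, tcomp_nonempty ha⟩

/-- A cube of a component generates it. [cite: Balaban1988RG2Cluster, (2.10) p.14] -/
theorem tcomp_eq_of_mem_tcomps {S : Finset (TPt d N)} {K : Finset (TPt d N)} (hK : K ∈ tcomps S) {x : TPt d N}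
    (hx : x ∈ K) : tcomp S x = K := by
  obtain ⟨a, -, rfl⟩ := mem_tcomps.1 hK
  exact tcomp_eq_of_mem hx

/-- **Distinct components are disjoint** (Z = ∪_i Z_i is a partition). [cite: Balaban1988RG2Cluster, (2.10) p.14] -/
theorem tcomps_disjoint {S : Finset (TPt d N)} {K K' : Finset (TPt d N)} (hK : K ∈ tcomps S) (hK' : K' ∈ tcomps S)
    (hne : K ≠ K') : Disjoint K K' := by
  rw [Finset.disjoint_left]
  intro x hxK hxK'
  exact hne ((tcomp_eq_of_mem_tcomps hK hxK).symm.trans (tcomp_eq_of_mem_tcomps hK' hxK'))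

/-- The component of a cube of S̄ is the unique component containing it. [cite: Balaban1988RG2Cluster, (2.10) p.14] -/
theorem eq_of_mem_of_mem_tcomps {S : Finset (TPt d N)} {K K' : Finset (TPt d N)} (hK : K ∈ tcomps S)
    (hK' : K' ∈ tcomps S) {x : TPt d N} (hxK : x ∈ K) (hxK' : x ∈ K') : K = K' := by
  by_contra hne
  exact Finset.disjoint_left.1 (tcomps_disjoint hK hK' hne) hxK hxK'

/-- **Distinct components have no common wall ON THE TORUS** (they are ζ-compatible in the sense of (2.11) p. 14:
*"ζ(Z, Z′) = 0 if Z ∩ Z′ contains a cube, or a wall of a cube"*): a torus wall between cubes of S̄ is a chain step,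
so both cubes lie in one component; window version `B13Eq210Components.compsF_pairwise`. [cite: Balaban1988RG2Cluster, (2.10)–(2.11) p.14] -/
theorem tcomps_sep {S : Finset (TPt d N)} {K K' : Finset (TPt d N)} (hK : K ∈ tcomps S) (hK' : K' ∈ tcomps S)
    (hne : K ≠ K') {x y : TPt d N} (hx : x ∈ K) (hy : y ∈ K') : ¬ TAdj x y := by
  intro hxy
  have hxS : x ∈ S := (subset_of_mem_tcomps hK).1 hx
  have hyS : y ∈ S := (subset_of_mem_tcomps hK').1 hy
  have hyx : y ∈ tcomp S x := mem_tcomp.2 ⟨hyS, Relation.ReflTransGen.single ⟨hxS, hyS, hxy⟩⟩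
  rw [tcomp_eq_of_mem_tcomps hK hx] at hyx
  exact hne (eq_of_mem_of_mem_tcomps hK hK' hyx hy)

/-- **Z = Z₁ ∪ … ∪ Z_n (2.10)**: a family of cubes of the torus is the union of its components. [cite: Balaban1988RG2Cluster, (2.10) p.14] -/
theorem biUnion_tcomps (S : Finset (TPt d N)) : (tcomps S).biUnion id = S := by
  ext b
  simp only [Finset.mem_biUnion, id, mem_tcomps]
  constructor
  · rintro ⟨K, ⟨a, -, rfl⟩, hb⟩
    exact tcomp_subset S a hb
  · intro hb
    exact ⟨tcomp S b, ⟨b, hb, rfl⟩, mem_tcomp_self hb⟩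

/-- Every component is a localization domain of the torus (non-empty, torus-face-connected: `TreeLengthTorus.IsTDom`)
— p. 19: the components *"are localization domains from 𝐃_{k+1}"*; window version `B13Eq210Components.isDom_compF`.
[cite: Balaban1988RG2Cluster, p.19 (components are localization domains)] -/
theorem isTDom_of_mem_tcomps [NeZero N] {S : Finset (TPt d N)} {K : Finset (TPt d N)} (hK : K ∈ tcomps S) :
    IsTDom K := by
  obtain ⟨a, ha, rfl⟩ := mem_tcomps.1 hK
  exact ⟨tcomp_nonempty ha, tFaceConnected_tcomp S a⟩

/-- The component of a cube of S̄ is a localization domain of the torus. [cite: Balaban1988RG2Cluster, p.19 (components are localization domains)] -/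
theorem isTDom_tcomp [NeZero N] {S : Finset (TPt d N)} {a : TPt d N} (ha : a ∈ S) : IsTDom (tcomp S a) :=
  isTDom_of_mem_tcomps (mem_tcomps.2 ⟨a, ha, rfl⟩)

/-- A non-empty family has at least one component. [cite: Balaban1988RG2Cluster, (2.10) p.14] -/
theorem tcomps_nonempty {S : Finset (TPt d N)} (hS : S.Nonempty) : (tcomps S).Nonempty :=
  hS.image _

/-- P. 17: *"this decomposition induces the decomposition of the families 𝐃, 𝐃 = ∪_i 𝐃_i, 𝐃_i satisfy ∪_{Y∈𝐃_i} Y =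
Y_i"* — its geometric content ON THE TORUS: a connected family Ȳ inside S̄ lies inside ONE component of S̄, the
component of any of its cubes; window version `B13Lemma3AssemblyWindow.subset_compF_of_faceConnected`. [cite: Balaban1988RG2Cluster, p.17 (resummation order)] -/
theorem subset_tcomp_of_tFaceConnected {Y S : Finset (TPt d N)} (hYc : TFaceConnected Y) (hYS : Y ⊆ S)
    {a : TPt d N} (ha : a ∈ Y) : Y ⊆ tcomp S a := fun b hb =>
  mem_tcomp.2 ⟨hYS hb, tLinked_mono hYS (hYc a ha b hb)⟩

/-- A connected S̄ is its own single component. [cite: Balaban1988RG2Cluster, (2.10) p.14] -/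
theorem tcomp_eq_self_of_tFaceConnected {S : Finset (TPt d N)} (hS : TFaceConnected S) {a : TPt d N} (ha : a ∈ S) :
    tcomp S a = S :=
  Finset.Subset.antisymm (tcomp_subset S a) (subset_tcomp_of_tFaceConnected hS subset_rfl ha)

/-- A connected non-empty S̄ has exactly one component, itself. [cite: Balaban1988RG2Cluster, (2.10) p.14] -/
theorem tcomps_eq_singleton_of_tFaceConnected {S : Finset (TPt d N)} (hS : TFaceConnected S) (hne : S.Nonempty) :
    tcomps S = {S} := by
  ext K
  simp only [mem_tcomps, Finset.mem_singleton]
  constructor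
  · rintro ⟨a, ha, rfl⟩
    exact tcomp_eq_self_of_tFaceConnected hS ha
  · rintro rfl
    obtain ⟨a, ha⟩ := hne
    exact ⟨a, ha, tcomp_eq_self_of_tFaceConnected hS ha⟩

/-! ## Part 2. The counting behind (2.32): every component meets an extra cube across a torus wall -/

/-- THE KEY GEOMETRIC FACT behind *"a simple geometric argument"* (p. 18): inside a torus localization domain
Z̄ ⊇ S̄, if S̄ has at least two components then every component K has a cube with a common torus wall to a cube of
Z̄ ∖ S̄ — a chain in Z̄ from K to another component must leave K (`TreeLengthTorus.exists_tfrontier`), and it cannot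
enter S̄ directly since the cube entered would be chained to K; the touching cube of K is coded as one of the 2d torus
shifts of the extra cube (`TreeLengthTorus.exists_tshift_of_tadj`).  Window version `B13Ineq232.CompData.exists_W_adj`.
[cite: Balaban1988RG2Cluster, (2.32) p.18] -/
theorem exists_sdiff_tadj {Z S : Finset (TPt d N)} (hZ : TFaceConnected Z) (hSZ : S ⊆ Z)
    (h2 : 1 < (tcomps S).card) {K : Finset (TPt d N)} (hK : K ∈ tcomps S) :
    ∃ q : TPt d N × (Fin d × Bool), q.1 ∈ Z \ S ∧ tshift q.1 q.2 ∈ K := by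
  obtain ⟨K', hK', hK'K⟩ := Finset.exists_mem_ne h2 K
  obtain ⟨hKS, ⟨a, ha⟩⟩ := subset_of_mem_tcomps hK
  obtain ⟨hK'S, ⟨b, hb⟩⟩ := subset_of_mem_tcomps hK'
  have hbK : b ∉ K := fun h => hK'K (eq_of_mem_of_mem_tcomps hK' hK hb h)
  obtain ⟨x, hxK, c, hcZ, hcK, hxc⟩ := exists_tfrontier (hKS.trans hSZ) hZ ha (hSZ (hK'S hb)) hbK
  have hcS : c ∉ S := by
    intro hcS
    have hcx : c ∈ tcomp S x := mem_tcomp.2 ⟨hcS, Relation.ReflTransGen.single ⟨hKS hxK, hcS, hxc⟩⟩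
    rw [tcomp_eq_of_mem_tcomps hK hxK] at hcx
    exact hcK hcx
  obtain ⟨p, hp⟩ := exists_tshift_of_tadj hxc.symm
  exact ⟨(c, p), Finset.mem_sdiff.2 ⟨hcZ, hcS⟩, hp ▸ hxK⟩

/-- COUNTING: with at least two components, `#components ≤ 2d·|Z̄ ∖ S̄|` — the map K ↦ (extra cube, shift code) of
`exists_sdiff_tadj` is injective because components are disjoint, and a cube of the torus has at most 2d walls.
Window version `B13Ineq232.CompData.card_parts_le_nat`. [cite: Balaban1988RG2Cluster, (2.32) p.18] -/
theorem card_tcomps_le_nat {Z S : Finset (TPt d N)} (hZ : TFaceConnected Z) (hSZ : S ⊆ Z)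
    (h2 : 1 < (tcomps S).card) : (tcomps S).card ≤ (Z \ S).card * (2 * d) := by
  classical
  obtain ⟨K₀, hK₀⟩ : (tcomps S).Nonempty := Finset.card_pos.mp (lt_trans zero_lt_one h2)
  obtain ⟨q₀, -⟩ := exists_sdiff_tadj hZ hSZ h2 hK₀
  choose f hf using fun K (hK : K ∈ tcomps S) => exists_sdiff_tadj hZ hSZ h2 hK
  let g : Finset (TPt d N) → TPt d N × (Fin d × Bool) := fun K => if h : K ∈ tcomps S then f K h else q₀
  have hg : ∀ K (hK : K ∈ tcomps S), g K = f K hK := fun K hK => dif_pos hK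
  have hmaps : Set.MapsTo g ↑(tcomps S) ↑((Z \ S) ×ˢ (Finset.univ : Finset (Fin d × Bool))) := by
    intro K hK
    have hK' : K ∈ tcomps S := hK
    rw [Finset.mem_coe, Finset.mem_product, hg K hK']
    exact ⟨(hf K hK').1, Finset.mem_univ _⟩
  have hinj : Set.InjOn g ↑(tcomps S) := by
    intro K hK K' hK' hKK'
    have h1 := (hf K hK).2
    have h1' := (hf K' hK').2
    rw [← hg K hK] at h1
    rw [← hg K' hK', ← hKK'] at h1'
    exact eq_of_mem_of_mem_tcomps hK hK' h1 h1'
  calc (tcomps S).card ≤ ((Z \ S) ×ˢ (Finset.univ : Finset (Fin d × Bool))).card :=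
        Finset.card_le_card_of_injOn g hmaps hinj
    _ = (Z \ S).card * (2 * d) := by
        rw [Finset.card_product, Finset.card_univ, Fintype.card_prod, Fintype.card_fin, Fintype.card_bool]
        ring

/-- COUNTING in the form used: `#components − 1 ≤ 2d·|Z̄ ∖ S̄|` for any number of components (one component: the
left side is ≤ 0).  Window version `B13Ineq232.CompData.card_parts_le`. [cite: Balaban1988RG2Cluster, (2.32) p.18] -/
theorem card_tcomps_sub_one_le {Z S : Finset (TPt d N)} (hZ : TFaceConnected Z) (hSZ : S ⊆ Z) :
    ((tcomps S).card : ℝ) - 1 ≤ 2 * (d : ℝ) * ((Z \ S).card : ℝ) := by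
  have hW : (0 : ℝ) ≤ (Z \ S).card := Nat.cast_nonneg _
  have hd : (0 : ℝ) ≤ d := Nat.cast_nonneg _
  by_cases h2 : 1 < (tcomps S).card
  · have h := card_tcomps_le_nat hZ hSZ h2
    have h' : ((tcomps S).card : ℝ) ≤ ((Z \ S).card : ℝ) * (2 * d) := by exact_mod_cast h
    nlinarith
  · have h' : ((tcomps S).card : ℝ) ≤ 1 := by exact_mod_cast (not_lt.mp h2)
    nlinarith

/-! ## Part 3. (2.32) on the torus -/

section Periodic

variable [NeZero N]

omit [NeZero N] in
/-- The gluing family behind (2.32): the components Y_i of S̄ together with the single extra cubes {□}, □ ∈ Z̄ ∖ S̄ —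
its union is Z̄. [folklore] -/
private theorem biUnion_tcomps_union_singletons {Z S : Finset (TPt d N)} (hSZ : S ⊆ Z) :
    (tcomps S ∪ (Z \ S).image fun w => ({w} : Finset (TPt d N))).biUnion id = Z := by
  classical
  rw [Finset.union_biUnion, biUnion_tcomps]
  ext x
  simp only [Finset.mem_union, Finset.mem_biUnion, Finset.mem_image, Finset.mem_sdiff, id]
  constructor
  · rintro (hx | ⟨K, ⟨w, ⟨hwZ, -⟩, rfl⟩, hx⟩)
    · exact hSZ hx
    · rw [Finset.mem_singleton] at hx
      rw [hx]
      exact hwZ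
  · intro hxZ
    by_cases hxS : x ∈ S
    · exact Or.inl hxS
    · exact Or.inr ⟨{x}, ⟨x, ⟨hxZ, hxS⟩, rfl⟩, Finset.mem_singleton_self x⟩

omit [NeZero N] in
/-- The components and the singletons of extra cubes are different families (a component lies inside S̄, a singleton
{□} with □ ∉ S̄ does not). [folklore] -/
private theorem disjoint_tcomps_singletons {Z S : Finset (TPt d N)} :
    Disjoint (tcomps S) ((Z \ S).image fun w => ({w} : Finset (TPt d N))) := by
  classical
  rw [Finset.disjoint_left]
  intro K hK hK'
  obtain ⟨w, hw, rfl⟩ := Finset.mem_image.1 hK'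
  have hwS : w ∈ S := (subset_of_mem_tcomps hK).1 (Finset.mem_singleton_self w)
  exact (Finset.mem_sdiff.1 hw).2 hwS

/-- **(2.32) ON THE TORUS** — for (2.32) p. 18, verbatim *"Σ_i d_k(Y_i) + 4M⁻⁴|Z₀∖Y₀| ≧ d_k(Z₀)"* (FALSE with the
constant 4, cell GAPS.md G-B13-08), the kernel-checked replacement on the papers' periodic carrier: for a torus
localization domain Z̄ (*"one of the components"* of the set Z₀) and a non-empty S̄ ⊆ Z̄ (the set Y₀ = ∪_i Y_i, or on
p. 20 the set Z′₀) with components Y_i = `tcomps S̄`,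
`torusTreeLen Z̄ ≤ Σ_i torusTreeLen Y_i + (2 + 4d)·|Z̄ ∖ S̄|`.
Proof: (2.27) on the torus (`TreeLengthTorusGeometry.torusTreeLen_biUnion_add_two_le`: for a family with connected union,
d(∪) + 2 ≤ Σ (d(member) + 2)) applied to the family {Y_i} ∪ {{□} : □ ∈ Z̄ ∖ S̄} whose union is Z̄, single cubes having
size 0 (`torusTreeLen_singleton`), gives d(Z̄) ≤ Σ_i d(Y_i) + 2|Z̄ ∖ S̄| + 2(n − 1), and n − 1 ≤ 2d|Z̄ ∖ S̄|
(`card_tcomps_sub_one_le`).  Window version `B13Ineq232TreeLength.ineq232_treeLen` (constant 1 + 4d).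
[cite: Balaban1988RG2Cluster, (2.32) p.18] -/
theorem ineq232_torus {Z S : Finset (TPt d N)} (hZ : TFaceConnected Z) (hSZ : S ⊆ Z) (hS : S.Nonempty) :
    torusTreeLen Z ≤ ∑ K ∈ tcomps S, torusTreeLen K + (2 + 4 * (d : ℝ)) * ((Z \ S).card : ℝ) := by
  classical
  set Sing : Finset (Finset (TPt d N)) := (Z \ S).image fun w => ({w} : Finset (TPt d N)) with hSing
  set D : Finset (Finset (TPt d N)) := tcomps S ∪ Sing with hD
  have hDne : D.Nonempty := (tcomps_nonempty hS).mono Finset.subset_union_left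
  have hmem : ∀ Y ∈ D, Y.Nonempty ∧ TFaceConnected Y := by
    intro Y hY
    rcases Finset.mem_union.1 hY with hY | hY
    · exact isTDom_of_mem_tcomps hY
    · obtain ⟨w, -, rfl⟩ := Finset.mem_image.1 hY
      refine ⟨Finset.singleton_nonempty w, fun x hx y hy => ?_⟩
      rw [Finset.mem_singleton] at hx hy
      rw [hx, hy]
      exact Relation.ReflTransGen.refl
  have hU : D.biUnion id = Z := by rw [hD, hSing]; exact biUnion_tcomps_union_singletons hSZ
  have hUc : TFaceConnected (D.biUnion id) := by rw [hU]; exact hZ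
  have h227 := torusTreeLen_biUnion_add_two_le hDne hmem hUc
  rw [hU] at h227
  -- split the sum over the two disjoint families
  have hdisj : Disjoint (tcomps S) Sing := by rw [hSing]; exact disjoint_tcomps_singletons
  have hinj : Set.InjOn (fun w => ({w} : Finset (TPt d N))) ↑(Z \ S) :=
    fun w _ w' _ h => Finset.singleton_injective h
  have hSingSum : ∑ Y ∈ Sing, (torusTreeLen Y + 2) = 2 * ((Z \ S).card : ℝ) := by
    rw [hSing, Finset.sum_image hinj]
    simp only [torusTreeLen_singleton, zero_add, Finset.sum_const, nsmul_eq_mul]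
    ring
  have hsplit : ∑ Y ∈ D, (torusTreeLen Y + 2) =
      ∑ K ∈ tcomps S, torusTreeLen K + 2 * ((tcomps S).card : ℝ) + 2 * ((Z \ S).card : ℝ) := by
    rw [hD, Finset.sum_union hdisj, hSingSum, Finset.sum_add_distrib, Finset.sum_const, nsmul_eq_mul]
    ring
  rw [hsplit] at h227
  have hcount := card_tcomps_sub_one_le hZ hSZ
  have hW : (0 : ℝ) ≤ (Z \ S).card := Nat.cast_nonneg _
  nlinarith

/-- d = 4 (the series): `torusTreeLen Z̄ ≤ Σ_i torusTreeLen Y_i + 18·|Z̄ ∖ S̄|` — the constant 18 in place of the printed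
4 is EXACTLY the b13 sub-cell's hand repair recorded in `B13.Consts.R16repaired` (18κ ≤ γ₂ε₁²γ⁻²/20, cell GAPS.md
G-B13-08). [cite: Balaban1988RG2Cluster, (2.32) p.18] -/
theorem ineq232_torus_four {N : ℕ} [NeZero N] {Z S : Finset (TPt 4 N)} (hZ : TFaceConnected Z) (hSZ : S ⊆ Z)
    (hS : S.Nonempty) :
    torusTreeLen Z ≤ ∑ K ∈ tcomps S, torusTreeLen K + 18 * ((Z \ S).card : ℝ) := by
  have h := ineq232_torus hZ hSZ hS
  norm_num at h
  exact h

/-- The one-component case (S̄ connected: the situation of a single polymer), where the left sum has the single term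
d(S̄) — here the sharper adjoining bound with constant 1 holds ([Dimock2013] §4 Lemma 20 on the torus,
`TreeLengthTorusTransfer.torusTreeLen_le_card_sdiff_add`); recorded to make the comparison explicit. [cite: Dimock2013, §4 Lemma 20] -/
theorem torusTreeLen_le_of_single {S Z : Finset (TPt d N)} (hS : S.Nonempty) (hSZ : S ⊆ Z) (hSc : TFaceConnected S)
    (hZc : TFaceConnected Z) : torusTreeLen Z ≤ torusTreeLen S + ((Z \ S).card : ℝ) := by
  have h := torusTreeLen_le_card_sdiff_add hS hSZ hSc hZc
  linarith

/-- (2.32) on the torus for the `TDom`-packaged catalogue `TreeLengthTorus.tsys d N` (d_j = `torusTreeLen`): for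
Z̄ ∈ 𝐃_j and ∅ ≠ S̄ ⊆ Z̄, `(tsys d N).dj Z̄ ≤ Σ_{K ∈ tcomps S̄} torusTreeLen K + (2 + 4d)|Z̄ ∖ S̄|`. [cite: Balaban1988RG2Cluster, (2.32) p.18] -/
theorem ineq232_tsys (Z : (tsys d N).Dom) {S : Finset (TPt d N)} (hSZ : S ⊆ Z.1) (hS : S.Nonempty) :
    (tsys d N).dj Z ≤ ∑ K ∈ tcomps S, torusTreeLen K + (2 + 4 * (d : ℝ)) * ((Z.1 \ S).card : ℝ) :=
  ineq232_torus Z.2.2 hSZ hS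

end Periodic

end Literature.MathematicalPhysics.QuantumFieldTheory.Balaban1983to89.B13Ineq232Torus

end
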